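import Mathlib
import HarnessLib
import Summits.NavierStokesRegularity.NavierStokesRegularity.Theorems.TypeILiouvilleStrainLedgerOsgoodFloor
import Literature.Analysis.FluidPDE.TypeIAncientMild

/-!
# TypeILiouvilleStrainLedgerOsgoodTypeIGauge — crux (L) stmt-NavierStokesRegularity-10661 `TypeIliouvilleL`,
# registered stub `stub_typeIAncientLiouville_knssGauge` (door stmt-4050): THE OSGOOD FLOOR ON THE STUB'S LITERAL CLASS

Helper for stmt-NavierStokesRegularity-10661 (`--supports`); theorems only, no definitions, no named-fact hypotheses;
closes no item; Navier–Stokes regularity is NOT proved here (leafhand seat of the EulerZoomLiouville route).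

The Osgood stretching floor of `TypeILiouvilleStrainLedgerOsgoodFloor` (print's bounded class P) transported to the
Type-I ancient mild class `IsTypeIAncientMild C u` — the class of the LOAD-BEARING registered stub L' — by the backward
time shift `t ↦ u(t − δ)` (which lands in class P: bounded by `C/√δ`, Oseen-mild, weakly divergence free) and the
Oseen gauge (`IsTypeIAncientMild.eq_zero_of_slice_const`: slice-constant Type-I fields vanish).

* `typeI_eq_zero_of_stretching_divergent_deficit` — **OSGOOD FLOOR ON THE TYPE-I CLASS**: a Type-I ancient mild field
  with `(−τ)‖∇u(τ,x)‖ ≤ a(τ) ≤ A` for all `τ < T` (`a` continuous) and DIVERGENT deficit integral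
  `∫_s^T (1 − a(τ)) dτ/(−τ) → +∞` (`s → −∞`) vanishes identically.  Strictly contains the threshold cell
  `typeI_eq_zero_of_stretching_le` (`a ≡ a₀ < 1`, deficit `(1−a₀) log(−s)`) of `TypeILiouvilleStrainLedgerTypeIGauge`
  on the far-past side, and complements its temporal-gauge certificate (whose deficit must grow like `δ·log(−s)`):
  here ANY divergent deficit suffices, e.g. `c·log log(−s)`.
* `typeI_eq_zero_of_stretching_le_one_sub_div_log` — the log cell `(−τ)‖∇u(τ,x)‖ ≤ 1 − c/log(−τ)` (`τ < T < −1`).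
* `knssGauge_eq_zero_of_stretching_divergent_deficit` / `knssGauge_eq_zero_of_stretching_le_one_sub_div_log` — the
  same two on the stub's LITERAL KNSS-gauge hypotheses (`isTypeIAncientMild_iff`): the registered stub HOLDS on the
  Osgood-subcritical stratum; what remains is the Type-I class with NON-divergent stretching deficit (stretching
  number `≥ 1 − c/log(−τ)` somewhere below every `T`, for every `c > 0`).

HONEST LABEL: Grönwall bookkeeping; the scale-invariant corner (stretching number `1`, any Type-I constant) = door 4050
stays open; nothing here proves a registered stub, (L), or NS regularity; rung 0.
[cite: KochNadirashviliSereginSverak2009, §1 p. 3, §4 (i) p. 8, Remark 6.1 (arXiv:0709.3599)] [cite: MajdaBertozziCUP2002, eq. (3.80)]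
-/

noncomputable section
open MeasureTheory Filter Set Function Metric
open scoped Topology RealInnerProductSpace ENNReal NNReal
open Literature.Analysis Literature.Analysis.FluidPDE Literature.Analysis.UnboundedOperators
set_option linter.dupNamespace false
namespace Summit.NavierStokesRegularity.NavierStokesRegularity.Theorems.TypeILiouvilleStrainLedger

/-! ## §1 The Osgood floor on the Type-I ancient mild class -/

/-- **OSGOOD FLOOR ON THE TYPE-I CLASS.**  Let `u` be a Type-I ancient mild field (`IsTypeIAncientMild C u`) whose
stretching number obeys `(−τ)·‖∇u(τ,x)‖ ≤ a(τ) ≤ A` for all `τ < T < 0` and all `x`, with `a` continuous.  If the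
deficit integral diverges, `∫_s^T (1 − a(τ)) dτ/(−τ) → +∞` as `s → −∞`, then `u ≡ 0`.  Proof: for `t < 0` put
`δ = −t/2`; the shift `V(τ) = u(τ − δ)` is in class P, its stretching form is `≤ (a(τ−δ)/(δ−τ))‖ξ‖²` and its vorticity
`≤ ‖curl‖·A/(δ−τ)` for `τ < T`, and the ledger of `[s,T]` equals `‖curl‖·A/(δ−T) · exp(−∫_{s−δ}^{T−δ} (1−a)/(−σ)) → 0`;
so `V` is one constant vector (`const_of_pastLedger_tendsto_zero`), every slice of `u` is constant, and the Oseen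
gauge with the Type-I bound kills slice-constant fields (`IsTypeIAncientMild.eq_zero_of_slice_const`).
[cite: KochNadirashviliSereginSverak2009, §4 (i) p. 8, Remark 6.1 (arXiv:0709.3599)] [cite: MajdaBertozziCUP2002, eq. (3.80)] -/
theorem typeI_eq_zero_of_stretching_divergent_deficit {C : ℝ}
    {u : ℝ → EuclideanSpace ℝ (Fin 3) → EuclideanSpace ℝ (Fin 3)} (hu : IsTypeIAncientMild C u)
    {T : ℝ} (hT : T < 0) {a : ℝ → ℝ} (hac : Continuous a) {A : ℝ} (haA : ∀ τ < T, a τ ≤ A)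
    (hstr : ∀ τ < T, ∀ x : EuclideanSpace ℝ (Fin 3), (-τ) * ‖fderiv ℝ (u τ) x‖ ≤ a τ)
    (hdiv : Tendsto (fun s : ℝ => ∫ τ in s..T, (1 - a τ) / (-τ)) atBot atTop) :
    ∀ t < 0, ∀ x, u t x = 0 := by
  -- gradient form of the hypothesis
  have hg : ∀ τ < T, ∀ x : EuclideanSpace ℝ (Fin 3), ‖fderiv ℝ (u τ) x‖ ≤ a τ / (-τ) := by
    intro τ hτ x
    have hτ0 : 0 < -τ := by linarith
    rw [le_div_iff₀ hτ0, mul_comm]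
    exact hstr τ hτ x
  -- every slice is a constant vector
  have hslice : ∀ t < 0, ∃ b : EuclideanSpace ℝ (Fin 3), ∀ x, u t x = b := by
    intro t ht
    set δ : ℝ := -t / 2 with hδ_def
    have hδ : 0 < δ := by rw [hδ_def]; linarith
    have htδ : t + δ < 0 := by rw [hδ_def]; linarith
    -- the shifted field is in class P
    have hV : IsTypeIAncientMild C (fun τ => u (τ - δ)) := hu.comp_sub_right hδ.le
    have hc : ContinuousOn (uncurry fun τ x => u (τ - δ) x) (Iio 0 ×ˢ univ) := hV.continuousOn_uncurry
    have hK : ∃ K : ℝ, ∀ τ < 0, ∀ x, ‖u (τ - δ) x‖ ≤ K := by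
      refine ⟨C / Real.sqrt δ, fun τ hτ x => (hu.norm_le (t := τ - δ) (by linarith) x).trans ?_⟩
      exact div_le_div_of_nonneg_left hu.nonneg (Real.sqrt_pos.2 hδ) (Real.sqrt_le_sqrt (by linarith))
    have hd : ∀ τ < 0, IsWeaklyDivFree (u (τ - δ)) := fun τ hτ => hV.isWeaklyDivFree hτ
    have hm : ∀ s τ : ℝ, s < τ → τ < 0 → ∀ x,
        u (τ - δ) x = heatExtension (u (s - δ)) (τ - s) x -
          oseenDuhamel 1 s (fun σ x => u (σ - δ) x) (fun σ x => u (σ - δ) x) τ x :=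
      fun s τ hsτ hτ x => hV.mild_eq_heatExtension hsτ hτ x
    -- majorants for the shifted field, continuous on `ℝ`
    have hδT : 0 < δ - T := by linarith
    set Λ : ℝ → ℝ := fun τ => a (τ - δ) / max (δ - τ) (δ - T) with hΛ
    have hden : ∀ τ : ℝ, max (δ - τ) (δ - T) ≠ 0 := fun τ => (lt_of_lt_of_le hδT (le_max_right _ _)).ne'
    have hΛc : Continuous Λ :=
      (hac.comp (continuous_id.sub continuous_const)).div
        ((continuous_const.sub continuous_id).max continuous_const) hden
    have hΛeq : ∀ τ, τ ≤ T → Λ τ = a (τ - δ) / (δ - τ) := fun τ hτ => by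
      simp only [hΛ, max_eq_left (sub_le_sub_left hτ δ)]
    have hstrV : ∀ τ < T, ∀ x ξ : EuclideanSpace ℝ (Fin 3),
        ⟪fderiv ℝ (u (τ - δ)) x ξ, ξ⟫ ≤ Λ τ * ‖ξ‖ ^ 2 := by
      intro τ hτ x ξ
      have h1 : ‖fderiv ℝ (u (τ - δ)) x‖ ≤ a (τ - δ) / (δ - τ) := by
        have h := hg (τ - δ) (by linarith) x
        rwa [show -(τ - δ) = δ - τ by ring] at h
      rw [hΛeq τ hτ.le]
      calc ⟪fderiv ℝ (u (τ - δ)) x ξ, ξ⟫ ≤ ‖fderiv ℝ (u (τ - δ)) x ξ‖ * ‖ξ‖ := real_inner_le_norm _ _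
        _ ≤ (‖fderiv ℝ (u (τ - δ)) x‖ * ‖ξ‖) * ‖ξ‖ :=
            mul_le_mul_of_nonneg_right (ContinuousLinearMap.le_opNorm _ _) (norm_nonneg _)
        _ ≤ (a (τ - δ) / (δ - τ) * ‖ξ‖) * ‖ξ‖ :=
            mul_le_mul_of_nonneg_right (mul_le_mul_of_nonneg_right h1 (norm_nonneg _)) (norm_nonneg _)
        _ = a (τ - δ) / (δ - τ) * ‖ξ‖ ^ 2 := by ring
    have hωV : ∀ τ < T, ∀ x : EuclideanSpace ℝ (Fin 3),
        ‖curl (u (τ - δ)) x‖ ≤ ‖curlCLM‖ * A / (δ - τ) := by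
      intro τ hτ x
      have hdτ : 0 < δ - τ := by linarith
      have h1 : ‖fderiv ℝ (u (τ - δ)) x‖ ≤ a (τ - δ) / (δ - τ) := by
        have h := hg (τ - δ) (by linarith) x
        rwa [show -(τ - δ) = δ - τ by ring] at h
      calc ‖curl (u (τ - δ)) x‖ = ‖curlCLM (fderiv ℝ (u (τ - δ)) x)‖ := rfl
        _ ≤ ‖curlCLM‖ * ‖fderiv ℝ (u (τ - δ)) x‖ := ContinuousLinearMap.le_opNorm _ _
        _ ≤ ‖curlCLM‖ * (a (τ - δ) / (δ - τ)) := mul_le_mul_of_nonneg_left h1 (norm_nonneg curlCLM)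
        _ ≤ ‖curlCLM‖ * (A / (δ - τ)) :=
            mul_le_mul_of_nonneg_left (div_le_div_of_nonneg_right (haA (τ - δ) (by linarith)) hdτ.le)
              (norm_nonneg curlCLM)
        _ = ‖curlCLM‖ * A / (δ - τ) := by ring
    -- the ledger of `[s,T]` in closed form, for `s < T`
    have hclosed : ∀ s < T, ‖curlCLM‖ * A / (δ - s) * Real.exp (∫ τ in s..T, Λ τ) =
        ‖curlCLM‖ * A / (δ - T) * Real.exp (-(∫ σ in (s - δ)..(T - δ), (1 - a σ) / (-σ))) := by
      intro s hs
      have hds : 0 < δ - s := by linarith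
      have hsT' : s - δ < T - δ := by linarith
      have hT' : T - δ < 0 := by linarith
      -- shift the integral and split `a/(−σ) = 1/(−σ) − (1−a)/(−σ)`
      have hcongr : ∫ τ in s..T, Λ τ = ∫ τ in s..T, a (τ - δ) / (-(τ - δ)) := by
        refine intervalIntegral.integral_congr fun τ hτ => ?_
        rw [uIcc_of_le hs.le] at hτ
        rw [hΛeq τ hτ.2, show -(τ - δ) = δ - τ by ring]
      have hshift : ∫ τ in s..T, a (τ - δ) / (-(τ - δ)) = ∫ σ in (s - δ)..(T - δ), a σ / (-σ) :=
        intervalIntegral.integral_comp_sub_right (fun σ => a σ / (-σ)) δ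
      have hsplit : ∫ σ in (s - δ)..(T - δ), a σ / (-σ) =
          ∫ σ in (s - δ)..(T - δ), (1 / (-σ) - (1 - a σ) / (-σ)) := by
        refine intervalIntegral.integral_congr fun σ _ => ?_
        rw [div_sub_div_same]; ring
      have hcont2 : ContinuousOn (fun σ : ℝ => (1 - a σ) / (-σ)) (uIcc (s - δ) (T - δ)) := by
        refine (continuousOn_const.sub hac.continuousOn).div continuousOn_id.neg fun σ hσ => ?_
        rw [uIcc_of_le hsT'.le] at hσ
        exact (neg_pos.2 (lt_of_le_of_lt hσ.2 hT')).ne'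
      have hcont1 : ContinuousOn (fun σ : ℝ => 1 / (-σ)) (uIcc (s - δ) (T - δ)) := by
        refine continuousOn_const.div continuousOn_id.neg fun σ hσ => ?_
        rw [uIcc_of_le hsT'.le] at hσ
        exact (neg_pos.2 (lt_of_le_of_lt hσ.2 hT')).ne'
      have hds' : δ - s ≠ 0 := hds.ne'
      have hdT' : δ - T ≠ 0 := hδT.ne'
      rw [hcongr, hshift, hsplit,
        intervalIntegral.integral_sub hcont1.intervalIntegrable hcont2.intervalIntegrable,
        integral_one_div_neg_eq_log hsT' hT', Real.exp_sub, Real.exp_sub,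
        show -(s - δ) = δ - s by ring, show -(T - δ) = δ - T by ring, Real.exp_log hds, Real.exp_log hδT,
        Real.exp_neg]
      field_simp
    -- divergence of the shifted deficit integral
    have hdiv' : Tendsto (fun s : ℝ => ∫ σ in (s - δ)..(T - δ), (1 - a σ) / (-σ)) atBot atTop := by
      -- `∫_{s−δ}^{T−δ} = ∫_{s−δ}^{T} − ∫_{T−δ}^{T}`
      have hT' : T - δ < 0 := by linarith
      have hcont : ContinuousOn (fun σ : ℝ => (1 - a σ) / (-σ)) (Iio 0) :=
        (continuousOn_const.sub hac.continuousOn).div continuousOn_id.neg fun σ hσ => (neg_pos.2 hσ).ne'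
      have hii : ∀ p q : ℝ, p < 0 → q < 0 → IntervalIntegrable (fun σ : ℝ => (1 - a σ) / (-σ)) volume p q := by
        intro p q hp hq
        refine (hcont.mono fun σ hσ => ?_).intervalIntegrable
        rcases le_total p q with h | h
        · rw [uIcc_of_le h] at hσ; exact lt_of_le_of_lt hσ.2 hq
        · rw [uIcc_of_ge h] at hσ; exact lt_of_le_of_lt hσ.2 hp
      have heq : ∀ s < T, ∫ σ in (s - δ)..(T - δ), (1 - a σ) / (-σ) =
          (∫ σ in (s - δ)..T, (1 - a σ) / (-σ)) - ∫ σ in (T - δ)..T, (1 - a σ) / (-σ) := by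
        intro s hs
        rw [eq_sub_iff_add_eq]
        exact intervalIntegral.integral_add_adjacent_intervals (hii _ _ (by linarith) hT') (hii _ _ hT' hT)
      have h0 : Tendsto (fun s : ℝ => s - δ) atBot atBot :=
        tendsto_atBot_atBot.2 fun b => ⟨b + δ, fun s hs => by linarith⟩
      have h1 : Tendsto (fun s : ℝ => ∫ σ in (s - δ)..T, (1 - a σ) / (-σ)) atBot atTop := hdiv.comp h0
      have h2 := tendsto_atTop_add_const_right atBot (-(∫ σ in (T - δ)..T, (1 - a σ) / (-σ))) h1
      refine h2.congr' ?_
      filter_upwards [eventually_lt_atBot T] with s hs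
      rw [heq s hs]
      exact (sub_eq_add_neg _ _).symm
    have hlim : Tendsto (fun s : ℝ => ‖curlCLM‖ * A / (δ - s) * Real.exp (∫ τ in s..T, Λ τ)) atBot (𝓝 0) := by
      have hexp : Tendsto (fun s : ℝ => ‖curlCLM‖ * A / (δ - T) *
          Real.exp (-(∫ σ in (s - δ)..(T - δ), (1 - a σ) / (-σ)))) atBot (𝓝 0) := by
        have h := (Real.tendsto_exp_atBot.comp (tendsto_neg_atTop_atBot.comp hdiv')).const_mul
          (‖curlCLM‖ * A / (δ - T))
        rw [mul_zero] at h
        exact h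
      refine hexp.congr' ?_
      filter_upwards [eventually_lt_atBot T] with s hs
      exact (hclosed s hs).symm
    obtain ⟨b, hb⟩ := const_of_pastLedger_tendsto_zero (v := fun τ x => u (τ - δ) x) hc hK hd hm hT hΛc
      (Ω := fun τ => ‖curlCLM‖ * A / (δ - τ)) hstrV hωV hlim
    refine ⟨b, fun x => ?_⟩
    have h := hb (t + δ) htδ x
    simp only [add_sub_cancel_right] at h
    exact h
  -- slice-constant Type-I fields vanish (Oseen gauge + Type-I decay)
  have hub : ∀ s < 0, ∀ y, u s y = u s 0 := by
    intro s hs y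
    obtain ⟨b, hb⟩ := hslice s hs
    rw [hb y, hb 0]
  intro t ht x
  exact hu.eq_zero_of_slice_const hub ht x

/-- **THE LOG CELL ON THE TYPE-I CLASS.**  A Type-I ancient mild field with `(−τ)·‖∇u(τ,x)‖ ≤ 1 − c/log(−τ)` for all
`τ < T < −1` and all `x` (`c > 0`) vanishes identically (deficit integral `c(log log(−s) − log log(−T)) → +∞`).
[cite: KochNadirashviliSereginSverak2009, §4 (i) (arXiv:0709.3599)] [cite: MajdaBertozziCUP2002, eq. (3.80)] -/
theorem typeI_eq_zero_of_stretching_le_one_sub_div_log {C : ℝ}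
    {u : ℝ → EuclideanSpace ℝ (Fin 3) → EuclideanSpace ℝ (Fin 3)} (hu : IsTypeIAncientMild C u)
    {T c : ℝ} (hT : T < -1) (hc0 : 0 < c)
    (hstr : ∀ τ < T, ∀ x : EuclideanSpace ℝ (Fin 3),
      (-τ) * ‖fderiv ℝ (u τ) x‖ ≤ 1 - c / Real.log (-τ)) :
    ∀ t < 0, ∀ x, u t x = 0 := by
  have hT0 : T < 0 := by linarith
  have hT1 : 1 < -T := by linarith
  set a : ℝ → ℝ := fun τ => 1 - c / Real.log (max (-τ) (-T)) with ha
  have hmax1 : ∀ τ : ℝ, 1 < max (-τ) (-T) := fun τ => lt_of_lt_of_le hT1 (le_max_right _ _)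
  have hlogpos : ∀ τ : ℝ, 0 < Real.log (max (-τ) (-T)) := fun τ => Real.log_pos (hmax1 τ)
  have hac : Continuous a := by
    refine continuous_const.sub (continuous_const.div ?_ fun τ => (hlogpos τ).ne')
    exact (continuous_neg.max continuous_const).log fun τ => (lt_trans zero_lt_one (hmax1 τ)).ne'
  have haeq : ∀ τ, τ ≤ T → a τ = 1 - c / Real.log (-τ) := fun τ hτ => by
    simp only [ha, max_eq_left (neg_le_neg hτ)]
  refine typeI_eq_zero_of_stretching_divergent_deficit hu hT0 hac (A := 1)
    (fun τ _ => by
      have : 0 ≤ c / Real.log (max (-τ) (-T)) := div_nonneg hc0.le (hlogpos τ).le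
      simp only [ha]; linarith)
    (fun τ hτ x => by rw [haeq τ hτ.le]; exact hstr τ hτ x) ?_
  have hclosed : ∀ s < T, ∫ τ in s..T, (1 - a τ) / (-τ) =
      c * (Real.log (Real.log (-s)) - Real.log (Real.log (-T))) := by
    intro s hs
    rw [← integral_div_neg_mul_log_eq hs hT]
    refine intervalIntegral.integral_congr fun τ hτ => ?_
    rw [uIcc_of_le hs.le] at hτ
    rw [haeq τ hτ.2, sub_sub_cancel, div_div, mul_comm]
  have hlim : Tendsto (fun s : ℝ => c * (Real.log (Real.log (-s)) - Real.log (Real.log (-T)))) atBot atTop := by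
    refine Tendsto.const_mul_atTop hc0 (tendsto_atTop_add_const_right _ _ ?_)
    exact Real.tendsto_log_atTop.comp (Real.tendsto_log_atTop.comp tendsto_neg_atBot_atTop)
  refine hlim.congr' ?_
  filter_upwards [eventually_lt_atBot T] with s hs
  exact (hclosed s hs).symm

/-! ## §2 On the literal hypotheses of the registered stub `stub_typeIAncientLiouville_knssGauge` -/

/-- The registered stub `stub_typeIAncientLiouville_knssGauge` HOLDS on the Osgood-subcritical stratum: its literal
hypotheses (KNSS gauge: jointly smooth, div-free slices, Oseen-kernel Duhamel identity, Type-I time decay) plus a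
continuous bounded stretching majorant `(−τ)‖∇u(τ,x)‖ ≤ a(τ) ≤ A` on a far past `τ < T < 0` with DIVERGENT deficit
integral `∫_s^T (1 − a)/(−τ) → +∞` give `u ≡ 0`. [cite: KochNadirashviliSereginSverak2009, §4 p. 8 (arXiv:0709.3599)] -/
theorem knssGauge_eq_zero_of_stretching_divergent_deficit (C : ℝ)
    (u : ℝ → EuclideanSpace ℝ (Fin 3) → EuclideanSpace ℝ (Fin 3))
    (hu : ContDiffOn ℝ (⊤ : ℕ∞) (Function.uncurry u) (Set.Iio 0 ×ˢ Set.univ) ∧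
      (∀ t < 0, Literature.Analysis.FluidPDE.VectorCalculus.IsDivFree (u t)) ∧
      (∀ s t : ℝ, s < t → t < 0 → ∀ x, u t x = Literature.Analysis.FluidPDE.heatFlow (u s) (t - s) x -
        ∫ τ in Set.Ioo s t, ∫ y, Literature.Analysis.FluidPDE.oseenKernel (t - τ) (x - y) (u τ y) (u τ y)) ∧
      Literature.Analysis.FluidPDE.HasTypeITimeDecay C u)
    {T : ℝ} (hT : T < 0) {a : ℝ → ℝ} (hac : Continuous a) {A : ℝ} (haA : ∀ τ < T, a τ ≤ A)
    (hstr : ∀ τ < T, ∀ x : EuclideanSpace ℝ (Fin 3), (-τ) * ‖fderiv ℝ (u τ) x‖ ≤ a τ)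
    (hdiv : Tendsto (fun s : ℝ => ∫ τ in s..T, (1 - a τ) / (-τ)) atBot atTop) :
    ∀ t < 0, ∀ x, u t x = 0 :=
  typeI_eq_zero_of_stretching_divergent_deficit (isTypeIAncientMild_iff.2 hu) hT hac haA hstr hdiv

/-- The registered stub `stub_typeIAncientLiouville_knssGauge` HOLDS on the log cell: its literal hypotheses plus
`(−τ)·‖∇u(τ,x)‖ ≤ 1 − c/log(−τ)` for all `τ < T < −1`, `x` (`c > 0`) give `u ≡ 0`.  What remains of the stub on this
axis: Type-I fields whose stretching number exceeds `1 − c/log(−τ)` somewhere below every `T`, for every `c > 0`.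
[cite: KochNadirashviliSereginSverak2009, §4 p. 8 (arXiv:0709.3599)] -/
theorem knssGauge_eq_zero_of_stretching_le_one_sub_div_log (C : ℝ)
    (u : ℝ → EuclideanSpace ℝ (Fin 3) → EuclideanSpace ℝ (Fin 3))
    (hu : ContDiffOn ℝ (⊤ : ℕ∞) (Function.uncurry u) (Set.Iio 0 ×ˢ Set.univ) ∧
      (∀ t < 0, Literature.Analysis.FluidPDE.VectorCalculus.IsDivFree (u t)) ∧
      (∀ s t : ℝ, s < t → t < 0 → ∀ x, u t x = Literature.Analysis.FluidPDE.heatFlow (u s) (t - s) x -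
        ∫ τ in Set.Ioo s t, ∫ y, Literature.Analysis.FluidPDE.oseenKernel (t - τ) (x - y) (u τ y) (u τ y)) ∧
      Literature.Analysis.FluidPDE.HasTypeITimeDecay C u)
    {T c : ℝ} (hT : T < -1) (hc0 : 0 < c)
    (hstr : ∀ τ < T, ∀ x : EuclideanSpace ℝ (Fin 3),
      (-τ) * ‖fderiv ℝ (u τ) x‖ ≤ 1 - c / Real.log (-τ)) :
    ∀ t < 0, ∀ x, u t x = 0 :=
  typeI_eq_zero_of_stretching_le_one_sub_div_log (isTypeIAncientMild_iff.2 hu) hT hc0 hstr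

end Summit.NavierStokesRegularity.NavierStokesRegularity.Theorems.TypeILiouvilleStrainLedger

end
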